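import Literature.AlgebraicGeometry.Motives.HodgeLieWeightOnePlusPairTwinIdeal
import Literature.AlgebraicGeometry.Motives.HodgeLieWeightOnePlusPairKilling
import Literature.Algebra.Lie.Sl2ModuleTraceParity
import Mathlib.LinearAlgebra.PID
import HarnessLib

/-!
# Weight one, plus pair with a twin `𝔰𝔩₂`-ideal: `κ(h', h') = 8`, `tr_{V_ℂ}(h'²) = dim V`, and `4 ∣ dim V`
# (Moonen–Zarhin (2.3): the type-III / Mumford position forces `dim V ≡ 0 mod 4`)

Topic `Literature/AlgebraicGeometry/Motives` (namespace `Literature.AlgebraicGeometry.Motives.HodgeStructure`).  Theorems only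
(no definition, no named fact; D-0026).  Sequel of `HodgeLieWeightOnePlusPairTwinIdeal` / `…TwinSl2` (the twin ideal `W` and its
`sl₂`-triple), `HodgeLieWeightOnePlusPairKilling` (`8 tr_{V_ℂ}(xy) = dim V · κ(x, y)`) and `Literature.Algebra.Lie.Sl2ModuleTraceParity`
(`Tr(H²)` is even on every `sl₂`-module), written for the cell `pub-hodge-ring2` (literature lane gen 67, programme R44 step F3j;
honest framing of that cell: research route conditional on HC_CM; not a corollary; Q11.4-sentence-2 already refuted in dim ≥ 3 —
this file is unconditional).

* `killingForm_eq_eight_of_twin` — for a Lie algebra `𝔏' = W ⊕ C` of operators with `[W, C] = 0` and `W = ⟨h', e', f'⟩` three-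
  dimensional with `[h', e'] = 2e'`, `[h', f'] = −2f'`: `κ_{𝔏'}(h', h') = 8` (`(ad h')²` takes values in `W`, where it is
  `diag(0, 4, 4)`).
* `trace_mul_self_eq_finrank_of_twin` — in the plus-pair position, `tr_{V_ℂ}(h'²) = dim_ℚ V` for the `h'` of a twin ideal.
* **`four_dvd_finrank_of_twin`** — hence `4 ∣ dim_ℚ V`: `h'` commutes with `Θ` and `C₀`, so `tr_P(h'²) = tr_Q(h'²) = dim V / 2`,
  and `tr_P(h'²)` is even (`exists_trace_restrict_mul_self_eq_two_mul_of_sl2Triple`).  For `dim V = 10` (abelian fivefolds) this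
  kills the twin branch of `exists_twin_ideal_of_plusPair`.

## References

* [MoonenZarhin1999LowDim] B. Moonen, Yu. Zarhin, *Hodge classes on abelian varieties of low dimension* (1999), §2 (2.3), §3.
* [Jacobson1962LieAlgebras] N. Jacobson, *Lie Algebras* (1962), Ch. III §8 (representations of `𝔰𝔩₂`), Ch. X §1.
* [Humphreys1972] J. E. Humphreys, *Introduction to Lie Algebras and Representation Theory* (1972), §7.2, §8.3.
* [Deligne1982HodgeCycles] P. Deligne, *Hodge cycles on abelian varieties*, LNM 900 (1982), I §3.
-/

open scoped TensorProduct

namespace Literature.AlgebraicGeometry.Motives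

open Module

universe u

namespace HodgeStructure

/-! ## §1 `κ(h', h') = 8` -/

/-- `tr T = Σ cᵢ` for an operator diagonal in a basis (`T bᵢ = cᵢ bᵢ`). Private plumbing. [folklore] -/
private theorem trace_eq_sum_of_apply_basis' {R ι M : Type*} [CommRing R] [Fintype ι] [DecidableEq ι] [AddCommGroup M]
    [Module R M] (b : Module.Basis ι R M) (T : M →ₗ[R] M) (c : ι → R) (hT : ∀ i, T (b i) = c i • b i) :
    LinearMap.trace R M T = ∑ i, c i := by
  rw [LinearMap.trace_eq_matrix_trace R b, Matrix.trace]
  refine Finset.sum_congr rfl fun i _ => ?_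
  rw [Matrix.diag_apply, LinearMap.toMatrix_apply, hT, map_smul, b.repr_self, Finsupp.smul_apply,
    Finsupp.single_eq_same, smul_eq_mul, mul_one]

set_option maxHeartbeats 800000 in
/-- **`κ_{𝔏'}(h', h') = 8` for the `h'` of a three-dimensional direct factor `W = ⟨h', e', f'⟩`** of a Lie algebra of operators
`𝔏' = W ⊕ C`, `[W, C] = 0`, `[h', e'] = 2e'`, `[h', f'] = −2f'`: `(ad h')²` takes values in `W` and is `diag(0, 4, 4)` there.
[cite: Jacobson1962LieAlgebras, Ch. III §8] [cite: Humphreys1972, §7.2 and §8.3] -/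
theorem killingForm_eq_eight_of_twin {M : Type*} [AddCommGroup M] [Module ℂ M] [Module.Finite ℂ M] :
    letI : LieRing (Module.End ℂ M) := LieRing.ofAssociativeRing
    ∀ (𝔏' : LieSubalgebra ℂ (Module.End ℂ M)) {W C : Submodule ℂ (Module.End ℂ M)},
      W ⊔ C = 𝔏'.toSubmodule → (∀ w ∈ W, ∀ c ∈ C, w * c = c * w) →
      ∀ {h' e' f' : Module.End ℂ M}, h' ∈ W → e' ∈ W → f' ∈ W →
      h' * e' - e' * h' = (2 : ℂ) • e' → h' * f' - f' * h' = -((2 : ℂ) • f') →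
      (∀ w ∈ W, ∃ a b c : ℂ, w = a • h' + b • e' + c • f') → Module.finrank ℂ W = 3 →
      ∀ hh𝔏 : h' ∈ 𝔏', killingForm ℂ 𝔏' ⟨h', hh𝔏⟩ ⟨h', hh𝔏⟩ = 8 := by
  letI : LieRing (Module.End ℂ M) := LieRing.ofAssociativeRing
  intro 𝔏' W C hWC hcommWC h' e' f' hh he hf hHE hHF hspan hW3 hh𝔏
  classical
  haveI : Module.Finite ℂ 𝔏' := Module.Finite.of_injective 𝔏'.toSubmodule.subtype Subtype.val_injective
  have hWle : W ≤ 𝔏'.toSubmodule := hWC ▸ le_sup_left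
  have hCle : C ≤ 𝔏'.toSubmodule := hWC ▸ le_sup_right
  set x : 𝔏' := ⟨h', hh𝔏⟩ with hxdef
  set T : Module.End ℂ 𝔏' := LieModule.toEnd ℂ 𝔏' 𝔏' x with hT
  have hTapply : ∀ z : 𝔏', ((T z : 𝔏') : Module.End ℂ M) = h' * z - z * h' := fun z => by
    rw [hT, LieModule.toEnd_apply_apply, LieSubalgebra.coe_bracket, LieRing.of_associative_ring_bracket]
  -- `[h', W] ⊆ W`, `[h', C] = 0`
  have hbrh : ∀ w ∈ W, h' * w - w * h' ∈ W := fun w hw => by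
    obtain ⟨a, b, c, rfl⟩ := hspan w hw
    have hcalc : h' * (a • h' + b • e' + c • f') - (a • h' + b • e' + c • f') * h' =
        b • (h' * e' - e' * h') + c • (h' * f' - f' * h') := by
      simp only [mul_add, add_mul, mul_smul_comm, smul_mul_assoc, smul_sub]; abel
    rw [hcalc, hHE, hHF]
    exact add_mem (W.smul_mem _ (W.smul_mem _ he)) (W.smul_mem _ (neg_mem (W.smul_mem _ hf)))
  set W' : Submodule ℂ 𝔏' := W.comap 𝔏'.toSubmodule.subtype with hW'def
  have hmemW' : ∀ z : 𝔏', z ∈ W' ↔ (z : Module.End ℂ M) ∈ W := fun z => Iff.rfl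
  have hTmem : ∀ z : 𝔏', T z ∈ W' := fun z => by
    rw [hmemW', hTapply]
    have hz : (z : Module.End ℂ M) ∈ W ⊔ C := by rw [hWC]; exact z.2
    obtain ⟨w, hw, c, hc, hwc⟩ := Submodule.mem_sup.1 hz
    rw [← hwc, mul_add, add_mul, hcommWC h' hh c hc, add_sub_add_right_eq_sub]
    exact hbrh w hw
  have hT2mem : ∀ z : 𝔏', (T * T) z ∈ W' := fun z => hTmem (T z)
  -- trace over `𝔏'` = trace of the restriction to `W'`
  have htr := LinearMap.trace_restrict_eq_of_forall_mem W' (T * T) hT2mem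
  -- basis `(h', e', f')` of `W'`
  let tW : Fin 3 → W' := ![⟨⟨h', hh𝔏⟩, hh⟩, ⟨⟨e', hWle he⟩, he⟩, ⟨⟨f', hWle hf⟩, hf⟩]
  have htW : ∀ i, (((tW i : W') : 𝔏') : Module.End ℂ M) = ![h', e', f'] i := fun i => by
    fin_cases i <;> rfl
  have hspanW : (⊤ : Submodule ℂ W') ≤ Submodule.span ℂ (Set.range tW) := by
    rintro ⟨⟨w, hw𝔏⟩, hw⟩ -
    obtain ⟨a, b, c, habc⟩ := hspan w hw
    have heq : (⟨⟨w, hw𝔏⟩, hw⟩ : W') = a • tW 0 + b • tW 1 + c • tW 2 := by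
      apply Subtype.ext; apply Subtype.ext
      simp only [AddMemClass.coe_add, SetLike.val_smul, htW]
      exact habc
    rw [heq]
    exact add_mem (add_mem (Submodule.smul_mem _ _ (Submodule.subset_span ⟨0, rfl⟩))
      (Submodule.smul_mem _ _ (Submodule.subset_span ⟨1, rfl⟩))) (Submodule.smul_mem _ _ (Submodule.subset_span ⟨2, rfl⟩))
  have hcard : Fintype.card (Fin 3) = Module.finrank ℂ W' := by
    rw [Fintype.card_fin, ← hW3]
    exact ((Submodule.comapSubtypeEquivOfLe hWle).finrank_eq).symm
  let bW := basisOfTopLeSpanOfCardEqFinrank tW hspanW hcard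
  have hbW : ∀ i, bW i = tW i := fun i => by rw [coe_basisOfTopLeSpanOfCardEqFinrank]
  -- `(ad h')²` is `diag(0, 4, 4)` in this basis
  have hT2 : ∀ z : 𝔏', (((T * T) z : 𝔏') : Module.End ℂ M) = h' * (h' * z - z * h') - (h' * z - z * h') * h' := fun z => by
    rw [Module.End.mul_apply, hTapply, hTapply]
  have hdiag : ∀ i, (T * T).restrict (fun z _ => hT2mem z) (bW i) = (![0, 4, 4] i : ℂ) • bW i := by
    intro i
    apply Subtype.ext; apply Subtype.ext
    change (((T * T) (bW i : 𝔏') : 𝔏') : Module.End ℂ M) = ((((![0, 4, 4] i : ℂ) • bW i : W') : 𝔏') : Module.End ℂ M)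
    rw [hT2, Submodule.coe_smul, SetLike.val_smul, hbW, htW]
    fin_cases i
    · show h' * (h' * h' - h' * h') - (h' * h' - h' * h') * h' = (0 : ℂ) • h'
      rw [sub_self, mul_zero, zero_mul, sub_self, zero_smul]
    · show h' * (h' * e' - e' * h') - (h' * e' - e' * h') * h' = (4 : ℂ) • e'
      rw [hHE, mul_smul_comm, smul_mul_assoc, ← smul_sub, hHE, smul_smul]; norm_num
    · show h' * (h' * f' - f' * h') - (h' * f' - f' * h') * h' = (4 : ℂ) • f'
      rw [hHF]
      have h4 : h' * -((2 : ℂ) • f') - -((2 : ℂ) • f') * h' = -((2 : ℂ) • (h' * f' - f' * h')) := by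
        rw [mul_neg, neg_mul, mul_smul_comm, smul_mul_assoc, smul_sub]; abel
      rw [h4, hHF, smul_neg, neg_neg, smul_smul]; norm_num
  have htrW : LinearMap.trace ℂ W' ((T * T).restrict (fun z _ => hT2mem z)) = 8 := by
    rw [trace_eq_sum_of_apply_basis' bW _ _ hdiag, Fin.sum_univ_three]
    show (0 : ℂ) + 4 + 4 = 8
    norm_num
  rw [killingForm, LieModule.traceForm_apply_apply]
  change LinearMap.trace ℂ 𝔏' (T * T) = 8
  rw [← htr, htrW]

/-! ## §2 `tr_{V_ℂ}(h'²) = dim V` and `4 ∣ dim V` -/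

variable {V : Type u} [AddCommGroup V] [Module ℚ V] [Module.Finite ℚ V] [HodgeTensorFacts.{u, u}] {n : ℤ}

set_option maxHeartbeats 800000 in
/-- **The twin branch forces `4 ∣ dim_ℚ V`** (weight `1`, plus pair, `𝔷 = 0`).  Let `𝔥_ℂ = W ⊕ C` with `ad`-stable `W`, `C`,
`[W, C] = 0`, `dim W = 3`, `W` commuting with `Θ` and `C₀` and spanned by an `sl₂`-triple `(h', e', f')` of operators
(`exists_twin_ideal_of_plusPair`, `exists_sl2Triple_of_twin`).  Then `κ(h', h') = 8` (`killingForm_eq_eight_of_twin`) and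
`8 tr_{V_ℂ}(xy) = dim V · κ(x, y)` (`eight_mul_trace_mul_eq_finrank_mul_killingForm_of_plusPair`) give `tr_{V_ℂ}(h'²) = dim V`;
`h'` preserves `P = V^{1,0}` and `Q = V^{0,1}`, `tr(h'²Θ) = μ₀⁻¹ tr(h'²[B₀, C₀]) = 0` (as `h'` commutes with `C₀`), so
`tr_P(h'²) = tr_Q(h'²) = dim V / 2`; and `tr_P(h'²)` is EVEN (`exists_trace_restrict_mul_self_eq_two_mul_of_sl2Triple`: `P` is an
`sl₂`-module).  Hence `dim V = 4N`.  For abelian FIVEFOLDS (`dim V = 10`) the twin branch is therefore impossible.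
[cite: MoonenZarhin1999LowDim, §2 (2.3) and §3] [cite: Jacobson1962LieAlgebras, Ch. III §8] -/
theorem four_dvd_finrank_of_twin (H : HodgeStructure V n) (ψ : H.Polarization) (hn : n = 1)
    (heff : H.IsEffective) {Θ : Module.End ℂ (ℂ ⊗[ℚ] V)}
    (hΘ : ∀ p, ∀ x ∈ H.piece p (n - p), Θ x = ((2 * p - n : ℤ) : ℂ) • x)
    {B₀ C₀ : Module.End ℂ (ℂ ⊗[ℚ] V)} (hB₀ : B₀ ∈ H.hodgeLieC) (hB₀0 : B₀ ≠ 0)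
    (hB₀P : ∀ p ∈ H.piece 1 0, B₀ p = 0) (hB₀im : ∀ v, B₀ v ∈ H.piece 1 0)
    (hC₀ : ∀ v, C₀ v = conj (B₀ (conj v))) {μ₀ : ℂ} (hμ₀ : μ₀ ≠ 0)
    (hBC : ∀ p ∈ H.piece 1 0, B₀ (C₀ p) = μ₀ • p) (hCB : ∀ q ∈ H.piece 0 1, C₀ (B₀ q) = μ₀ • q)
    (hline : ∀ B ∈ H.hodgeLieC, (∀ p ∈ H.piece 1 0, B p = 0) → (∀ v, B v ∈ H.piece 1 0) → ∃ c : ℂ, B = c • B₀)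
    (hline' : ∀ C ∈ H.hodgeLieC, (∀ q ∈ H.piece 0 1, C q = 0) → (∀ v, C v ∈ H.piece 0 1) → ∃ c : ℂ, C = c • C₀)
    (hz : H.hodgeLie ⊓ Subalgebra.toSubmodule H.endAlg = ⊥)
    {W C : Submodule ℂ (Module.End ℂ (ℂ ⊗[ℚ] V))} (hWC : W ⊔ C = H.hodgeLieC) (hW3 : Module.finrank ℂ W = 3)
    (hcommWC : ∀ w ∈ W, ∀ c ∈ C, w * c = c * w) (hWΘ : ∀ w ∈ W, w * Θ = Θ * w) (hWC₀ : ∀ w ∈ W, w * C₀ = C₀ * w)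
    {h' e' f' : Module.End ℂ (ℂ ⊗[ℚ] V)} (hh : h' ∈ W) (he : e' ∈ W) (hf : f' ∈ W)
    (hHE : h' * e' - e' * h' = (2 : ℂ) • e') (hHF : h' * f' - f' * h' = -((2 : ℂ) • f')) (hEF : e' * f' - f' * e' = h')
    (hspan : ∀ w ∈ W, ∃ a b c : ℂ, w = a • h' + b • e' + c • f') :
    4 ∣ Module.finrank ℚ V := by
  classical
  letI iC : LieRing (Module.End ℂ (ℂ ⊗[ℚ] V)) := LieRing.ofAssociativeRing
  obtain ⟨-, -, hcomm, -, -, hext⟩ := PlusPairTwin.facts H hn heff hΘ hB₀P hB₀im hC₀ hBC hCB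
  obtain ⟨𝔏', h𝔏'⟩ := exists_lieSubalgebra_eq_hodgeLieC H
  have hmem𝔏' : ∀ {x}, x ∈ 𝔏' ↔ x ∈ H.hodgeLieC := fun {x} => by rw [← LieSubalgebra.mem_toSubmodule, h𝔏']
  have hWle : W ≤ H.hodgeLieC := hWC ▸ le_sup_left
  have hh𝔏 : h' ∈ 𝔏' := hmem𝔏'.2 (hWle hh)
  have hkill := eight_mul_trace_mul_eq_finrank_mul_killingForm_of_plusPair H ψ hn heff hΘ hB₀ hB₀0 hB₀P hB₀im hC₀ hμ₀
    hBC hCB hline hline' hz 𝔏' h𝔏' ⟨h', hh𝔏⟩ ⟨h', hh𝔏⟩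
  have h8 : killingForm ℂ 𝔏' ⟨h', hh𝔏⟩ ⟨h', hh𝔏⟩ = 8 :=
    killingForm_eq_eight_of_twin 𝔏' (hWC.trans h𝔏'.symm) hcommWC hh he hf hHE hHF hspan hW3 hh𝔏
  -- `tr_V(h'²) = dim V`
  have htrV : LinearMap.trace ℂ (ℂ ⊗[ℚ] V) (h' * h') = (Module.finrank ℚ V : ℂ) := by
    rw [h8] at hkill
    have h : (8 : ℂ) * LinearMap.trace ℂ (ℂ ⊗[ℚ] V) (h' * h') = 8 * (Module.finrank ℚ V : ℂ) := by
      rw [mul_comm (8 : ℂ) (Module.finrank ℚ V : ℂ)]; exact hkill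
    exact mul_left_cancel₀ (by norm_num : (8 : ℂ) ≠ 0) h
  -- `P`, `Q`
  subst hn
  obtain ⟨hPmem, hQmem, hΘ10, hΘ01, -⟩ := UnitaryTheta.theta_facts H rfl heff hΘ
  have hpresP : ∀ G : Module.End ℂ (ℂ ⊗[ℚ] V), G * Θ = Θ * G → Set.MapsTo G (H.piece 1 0) (H.piece 1 0) := by
    intro G hG p hp
    have h1 : Θ (G p) = G p := by rw [← Module.End.mul_apply, ← hG, Module.End.mul_apply, hΘ10 p hp]
    have h2 := hPmem (G p)
    rwa [h1, ← two_smul ℂ (G p), smul_smul, inv_mul_cancel₀ (two_ne_zero' ℂ), one_smul] at h2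
  have hpresQ : ∀ G : Module.End ℂ (ℂ ⊗[ℚ] V), G * Θ = Θ * G → Set.MapsTo G (H.piece 0 1) (H.piece 0 1) := by
    intro G hG q hq
    have h1 : Θ (G q) = -G q := by rw [← Module.End.mul_apply, ← hG, Module.End.mul_apply, hΘ01 q hq, map_neg]
    have h2 := hQmem (G q)
    rwa [h1, sub_neg_eq_add, ← two_smul ℂ (G q), smul_smul, inv_mul_cancel₀ (two_ne_zero' ℂ), one_smul] at h2
  have hhP := hpresP h' (hWΘ h' hh)
  have heP := hpresP e' (hWΘ e' he)
  have hfP := hpresP f' (hWΘ f' hf)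
  have hhQ := hpresQ h' (hWΘ h' hh)
  -- `tr_P(h'²)` is even
  obtain ⟨N, hN⟩ := Literature.Algebra.Lie.exists_trace_restrict_mul_self_eq_two_mul_of_sl2Triple hHE hHF hEF hhP heP hfP
  -- the decomposition `V_ℂ = P ⊕ Q`
  have hPQv : ∀ v : ℂ ⊗[ℚ] V, (2 : ℂ)⁻¹ • (v + Θ v) + (2 : ℂ)⁻¹ • (v - Θ v) = v := fun v => by module
  have hcPQ : IsCompl (H.piece 1 0) (H.piece 0 1) := by
    refine ⟨disjoint_iff.2 (eq_bot_iff.2 fun x hx => ?_), codisjoint_iff.2 (eq_top_iff.2 fun v _ => ?_)⟩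
    · obtain ⟨hP, hQ⟩ := Submodule.mem_inf.1 hx
      rw [Submodule.mem_bot]
      have h1 := hΘ10 x hP
      rw [hΘ01 x hQ] at h1
      have h2 : (2 : ℂ) • x = 0 := by rw [two_smul]; nth_rewrite 1 [← h1]; rw [neg_add_cancel]
      exact (smul_eq_zero.1 h2).resolve_left (two_ne_zero' ℂ)
    · rw [← hPQv v]; exact Submodule.add_mem_sup (hPmem v) (hQmem v)
  let N' : Bool → Submodule ℂ (ℂ ⊗[ℚ] V) := fun b => cond b (H.piece 1 0) (H.piece 0 1)
  have hint : DirectSum.IsInternal N' :=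
    (DirectSum.isInternal_submodule_iff_isCompl N' (i := true) (j := false) (by decide)
      (Set.eq_univ_of_forall fun b => by cases b <;> simp).symm).2 hcPQ
  -- `tr_V(G) = tr_P(G|P) + tr_Q(G|Q)` for `G = h'²` and `G = h'²Θ`
  have hGΘ : ∀ {G : Module.End ℂ (ℂ ⊗[ℚ] V)}, G * Θ = Θ * G → (G * Θ) * Θ = Θ * (G * Θ) := fun {G} hG => by
    rw [hG, mul_assoc, hG]
  have hh2Θ : (h' * h') * Θ = Θ * (h' * h') := by rw [mul_assoc, hWΘ h' hh, ← mul_assoc, hWΘ h' hh, mul_assoc]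
  have hPP2 : Set.MapsTo (h' * h') (H.piece 1 0) (H.piece 1 0) := hpresP _ hh2Θ
  have hQQ2 : Set.MapsTo (h' * h') (H.piece 0 1) (H.piece 0 1) := hpresQ _ hh2Θ
  have hPP3 : Set.MapsTo (h' * h' * Θ) (H.piece 1 0) (H.piece 1 0) := hpresP _ (hGΘ hh2Θ)
  have hQQ3 : Set.MapsTo (h' * h' * Θ) (H.piece 0 1) (H.piece 0 1) := hpresQ _ (hGΘ hh2Θ)
  have hmaps2 : ∀ b, Set.MapsTo (h' * h') (N' b) (N' b) := fun b =>
    match b with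
    | true => hPP2
    | false => hQQ2
  have hmaps3 : ∀ b, Set.MapsTo (h' * h' * Θ) (N' b) (N' b) := fun b =>
    match b with
    | true => hPP3
    | false => hQQ3
  have hsplit := LinearMap.trace_eq_sum_trace_restrict hint hmaps2
  have hsplit' := LinearMap.trace_eq_sum_trace_restrict hint hmaps3
  rw [Fintype.sum_bool] at hsplit hsplit'
  have hsplit2 : LinearMap.trace ℂ (ℂ ⊗[ℚ] V) (h' * h') =
      LinearMap.trace ℂ (H.piece 1 0) ((h' * h').restrict hPP2) +
        LinearMap.trace ℂ (H.piece 0 1) ((h' * h').restrict hQQ2) := hsplit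
  have hsplit3 : LinearMap.trace ℂ (ℂ ⊗[ℚ] V) (h' * h' * Θ) =
      LinearMap.trace ℂ (H.piece 1 0) ((h' * h' * Θ).restrict hPP3) +
        LinearMap.trace ℂ (H.piece 0 1) ((h' * h' * Θ).restrict hQQ3) := hsplit'
  -- the restrictions
  have hrP : (h' * h' * Θ).restrict hPP3 = (h' * h').restrict hPP2 :=
    LinearMap.ext fun p => Subtype.ext (by
      change (h' * h' * Θ) p = (h' * h') p
      rw [Module.End.mul_apply, hΘ10 p p.2])
  have hrQ : (h' * h' * Θ).restrict hQQ3 = -((h' * h').restrict hQQ2) :=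
    LinearMap.ext fun q => Subtype.ext (by
      change (h' * h' * Θ) q = -((h' * h') q)
      rw [Module.End.mul_apply, hΘ01 q q.2, map_neg])
  have hrPP : (h' * h').restrict hPP2 = h'.restrict hhP * h'.restrict hhP :=
    LinearMap.ext fun p => Subtype.ext rfl
  -- `tr(h'²Θ) = 0`
  have htr0 : LinearMap.trace ℂ (ℂ ⊗[ℚ] V) (h' * h' * Θ) = 0 := by
    have hΘeq : Θ = μ₀⁻¹ • (B₀ * C₀ - C₀ * B₀) := by rw [hcomm, smul_smul, inv_mul_cancel₀ hμ₀, one_smul]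
    have h1 : LinearMap.trace ℂ (ℂ ⊗[ℚ] V) (h' * h' * (B₀ * C₀)) = LinearMap.trace ℂ (ℂ ⊗[ℚ] V) (C₀ * (h' * h' * B₀)) := by
      rw [← mul_assoc, LinearMap.trace_mul_comm]
    have h2 : C₀ * (h' * h' * B₀) = h' * h' * (C₀ * B₀) := by
      calc C₀ * (h' * h' * B₀) = (C₀ * h') * h' * B₀ := by noncomm_ring
        _ = (h' * C₀) * h' * B₀ := by rw [hWC₀ h' hh]
        _ = h' * (C₀ * h') * B₀ := by noncomm_ring
        _ = h' * (h' * C₀) * B₀ := by rw [hWC₀ h' hh]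
        _ = h' * h' * (C₀ * B₀) := by noncomm_ring
    rw [hΘeq, mul_smul_comm, map_smul, mul_sub, map_sub, h1, h2, sub_self, smul_zero]
  -- combine
  have hneg : LinearMap.trace ℂ (H.piece 0 1) (-((h' * h').restrict hQQ2)) =
      -LinearMap.trace ℂ (H.piece 0 1) ((h' * h').restrict hQQ2) := by
    rw [show -((h' * h').restrict hQQ2) = (-1 : ℂ) • (h' * h').restrict hQQ2 from
        (neg_one_smul ℂ ((h' * h').restrict hQQ2)).symm, map_smul, neg_one_smul]
  rw [hrP, hrQ, hneg, htr0] at hsplit3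
  rw [hrPP, hN, htrV] at hsplit2
  have hPQeq : LinearMap.trace ℂ (H.piece 0 1) ((h' * h').restrict hQQ2) = 2 * N := by
    rw [← hN, ← hrPP]; linear_combination hsplit3
  rw [hPQeq] at hsplit2
  -- `dim V = 4N`
  have hd : (Module.finrank ℚ V : ℤ) = 4 * N := by
    have h : ((Module.finrank ℚ V : ℤ) : ℂ) = ((4 * N : ℤ) : ℂ) := by push_cast; linear_combination hsplit2
    exact_mod_cast h
  exact Int.natCast_dvd_natCast.1 ⟨N, hd⟩

end HodgeStructure

end Literature.AlgebraicGeometry.Motives
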